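import Mathlib
import Literature.AlgebraicGeometry.Tropical.TorusCycles
import Summits.HodgeConjecture.HodgeConjecture.Theorems.TropicalWeilObstructionTropicalHodgeBoundWeilPairing
import HarnessLib

/-!
# The complex frame determinants of an effective tropical `n`-cycle balance at every facet class

Helper for crux K1 (`TropicalWeilVanishing`, stmt-HodgeConjecture-18478) of route `TropicalWeilObstruction` —
negation-sink work of cell `pub-hodge-tropical` (tropical-2 gen 11); it decides nothing about K1 and nothing
here bears on the Hodge conjecture.

For an effective tropical `n`-cycle `Z` on `ℝ²ⁿ/Q·ℤ²ⁿ` (any real `Q`), the closedness certificate says that in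
every facet class `f` the signed weighted frames cancel in `⋀ⁿℤ²ⁿ`:
`Σ_{(σ,i) ∈ f} (-1)ⁱ · sign π_{σ,i} · w_σ · vol_σ = 0` (`TropicalTorusCycle.balanced`, one equation per Plücker
coordinate). The complex frame determinant `η(L) = frameComplexDet n L = (dz₁ ∧ … ∧ dz_n)(l₁, …, l_n)` is a
LINEAR function of the frame `l₁ ∧ … ∧ l_n` — by the all-maps Cauchy–Binet identity
`Σ_S dz(S) · det L[S,·] = n! · η(L)` of `…TropicalHodgeBoundWeilPairing` — so the `η`'s balance too:

* `sum_facetClass_frameComplexDet_eq_zero` — **`Σ_{(σ,i) ∈ f} (-1)ⁱ · sign π_{σ,i} · w_σ · η_σ = 0`** for every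
  facet class `f` ("Kirchhoff law" for the `dz`-flux through every `(n-1)`-face);
* `frameComplexDet_eq_zero_of_isolated` — consequently a cell whose slot is ALONE in its facet class among the
  slots with `η ≠ 0` (all other slots of the class belong to Weil-null cells, `η = 0`) is itself Weil-null: a
  Weil-active cell (`η_σ ≠ 0`, the only cells contributing to `weilFunctional Z = Σ w_σ a_σ η_σ²`) is never
  bounded by Weil-null cells alone. This is the kernel form of the local test used in the cell's search for
  excess-type seeds (HOME `PILOT-6.1.md` §E14 (5), 'facet stars'): a `W`-carrying plate needs `W`-carrying
  partners at each of its facets.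

Pure linear algebra over the certificate; general `n`, any `Q`. No definition, no named fact, no sorry.
References: Mikhalkin–Zharkov, *Tropical eigenwave and intermediate Jacobians* (2014), Prop. 4.3;
Zharkov, *Tropical abelian varieties, Weil classes and the Hodge conjecture* (2020), §2.
-/

noncomputable section

-- `Summit.HodgeConjecture.HodgeConjecture.…` is the mandated namespace (single-conjunct summit).
set_option linter.dupNamespace false

open scoped BigOperators
open Matrix Literature.AlgebraicGeometry.Tropical

namespace Summit.HodgeConjecture.HodgeConjecture.Theorems.TropicalWeilVanishing.EtaBalance

variable {n : ℕ} {Q : Matrix (Fin (2 * n)) (Fin (2 * n)) ℝ}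

/-- The `dz`-coordinate `dz(S) = det P[·,S]`, `P = [1 | i·1]` (display-only, verbatim from
`…TropicalHodgeBoundWeilPairing`). -/
local notation3 (prettyPrint := false) "dz⟦" n "⟧" S:max =>
  (Matrix.det (Matrix.of fun k a : Fin n =>
    (if (S a : ℕ) = (k : ℕ) then (1 : ℂ) else 0) + (if (S a : ℕ) = (k : ℕ) + n then Complex.I else 0)))

/-- The signed weight `(-1)ⁱ · sign π_{σ,i} · w_σ` of the facet slot `(σ, i)`, as a complex number
(display-only abbreviation). -/
local notation3 (prettyPrint := false) "sw⟦" Z "⟧" σ:max i:max =>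
  (((TropicalTorusCycle.cell Z σ).weight : ℂ) * (-1 : ℂ) ^ ((i : Fin (_ + 1)) : ℕ) *
    (((Equiv.Perm.sign (TropicalTorusCycle.facetPerm Z σ i) : ℤˣ) : ℤ) : ℂ))

/-- The balancing certificate of a facet class, cast to `ℂ`: for every row selection `S`,
`Σ_{(σ,i) ∈ f} (-1)ⁱ sign π_{σ,i} w_σ · det L_σ[S,·] = 0`. [cite: MikhalkinZharkov2014Eigenwave, Prop. 4.3] -/
theorem sum_facetClass_pluckerCoord_eq_zero (Z : TropicalTorusCycle (2 * n) n Q)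
    (f : Fin Z.numFacetClasses) (S : Fin n → Fin (2 * n)) :
    (∑ σ, ∑ i : Fin (n + 1), if Z.facetClass σ i = f then
        sw⟦Z⟧ σ i * ((pluckerCoord (Z.cell σ).frame S : ℤ) : ℂ) else 0) = 0 := by
  have hb := congrArg (fun z : ℤ => (z : ℂ)) (Z.balanced f S)
  simp only [Int.cast_sum, Int.cast_ite, Int.cast_mul, Int.cast_pow, Int.cast_neg, Int.cast_one,
    Int.cast_natCast, Int.cast_zero] at hb
  exact hb

/-- **The complex frame determinants balance at every facet class**: for an effective tropical
`n`-cycle `Z` on `ℝ²ⁿ/Q·ℤ²ⁿ` and every facet class `f`,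
`Σ_{(σ,i) ∈ f} (-1)ⁱ · sign π_{σ,i} · w_σ · η_σ = 0`, `η_σ = frameComplexDet n L_σ`. Proof: `η` is linear in the
frame (`n! η(L) = Σ_S dz(S) det L[S,·]`) and the frames balance. [cite: MikhalkinZharkov2014Eigenwave, Prop. 4.3] -/
theorem sum_facetClass_frameComplexDet_eq_zero (Z : TropicalTorusCycle (2 * n) n Q)
    (f : Fin Z.numFacetClasses) :
    (∑ σ, ∑ i : Fin (n + 1), if Z.facetClass σ i = f then
        sw⟦Z⟧ σ i * frameComplexDet n (Z.cell σ).frame else 0) = 0 := by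
  have hfac : (Nat.factorial n : ℂ) ≠ 0 := Nat.cast_ne_zero.mpr (Nat.factorial_ne_zero n)
  apply mul_left_cancel₀ hfac
  rw [mul_zero, Finset.mul_sum]
  -- `n! · (slot term) = Σ_S dz(S) · (slot term with η replaced by det L[S,·])`
  have key : ∀ σ (i : Fin (n + 1)),
      (Nat.factorial n : ℂ) * (if Z.facetClass σ i = f then sw⟦Z⟧ σ i * frameComplexDet n (Z.cell σ).frame
        else 0) =
      ∑ S : Fin n → Fin (2 * n), dz⟦n⟧ S *
        (if Z.facetClass σ i = f then sw⟦Z⟧ σ i * ((pluckerCoord (Z.cell σ).frame S : ℤ) : ℂ) else 0) := by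
    intro σ i
    split_ifs with h
    · have hcb := TropicalHodgeBound.sum_dz_mul_pluckerCoord (n := n) (Z.cell σ).frame
      calc (Nat.factorial n : ℂ) * (sw⟦Z⟧ σ i * frameComplexDet n (Z.cell σ).frame)
          = sw⟦Z⟧ σ i * ((Nat.factorial n : ℂ) * frameComplexDet n (Z.cell σ).frame) := by ring
        _ = sw⟦Z⟧ σ i * ∑ S : Fin n → Fin (2 * n), dz⟦n⟧ S * ((pluckerCoord (Z.cell σ).frame S : ℤ) : ℂ) := by
              rw [hcb]
        _ = ∑ S : Fin n → Fin (2 * n), dz⟦n⟧ S *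
              (sw⟦Z⟧ σ i * ((pluckerCoord (Z.cell σ).frame S : ℤ) : ℂ)) := by
              rw [Finset.mul_sum]
              exact Finset.sum_congr rfl fun S _ => by ring
    · simp
  calc ∑ σ, (Nat.factorial n : ℂ) * ∑ i : Fin (n + 1),
          (if Z.facetClass σ i = f then sw⟦Z⟧ σ i * frameComplexDet n (Z.cell σ).frame else 0)
      = ∑ σ, ∑ i : Fin (n + 1), ∑ S : Fin n → Fin (2 * n), dz⟦n⟧ S *
          (if Z.facetClass σ i = f then sw⟦Z⟧ σ i * ((pluckerCoord (Z.cell σ).frame S : ℤ) : ℂ) else 0) := by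
        refine Finset.sum_congr rfl fun σ _ => ?_
        rw [Finset.mul_sum]
        exact Finset.sum_congr rfl fun i _ => key σ i
    _ = ∑ σ, ∑ S : Fin n → Fin (2 * n), ∑ i : Fin (n + 1), dz⟦n⟧ S *
          (if Z.facetClass σ i = f then sw⟦Z⟧ σ i * ((pluckerCoord (Z.cell σ).frame S : ℤ) : ℂ) else 0) :=
        Finset.sum_congr rfl fun σ _ => Finset.sum_comm
    _ = ∑ S : Fin n → Fin (2 * n), ∑ σ, ∑ i : Fin (n + 1), dz⟦n⟧ S *
          (if Z.facetClass σ i = f then sw⟦Z⟧ σ i * ((pluckerCoord (Z.cell σ).frame S : ℤ) : ℂ) else 0) :=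
        Finset.sum_comm
    _ = ∑ S : Fin n → Fin (2 * n), dz⟦n⟧ S * ∑ σ, ∑ i : Fin (n + 1),
          (if Z.facetClass σ i = f then sw⟦Z⟧ σ i * ((pluckerCoord (Z.cell σ).frame S : ℤ) : ℂ) else 0) := by
        refine Finset.sum_congr rfl fun S _ => ?_
        rw [Finset.mul_sum]
        exact Finset.sum_congr rfl fun σ _ => by rw [Finset.mul_sum]
    _ = 0 := by
        refine Finset.sum_eq_zero fun S _ => ?_
        rw [sum_facetClass_pluckerCoord_eq_zero Z f S, mul_zero]

/-- **A Weil-active cell is never bounded by Weil-null cells alone.** If the slot `(σ₀, i₀)` is the only slot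
of cell `σ₀` in its facet class and every OTHER cell with a slot in that class has `η = 0`, then `η_{σ₀} = 0`.
(So in any effective tropical `n`-cycle the cells with `η_σ ≠ 0` — the only ones contributing to
`weilFunctional Z` — meet other such cells across every facet.) [cite: MikhalkinZharkov2014Eigenwave, Prop. 4.3] -/
theorem frameComplexDet_eq_zero_of_isolated (Z : TropicalTorusCycle (2 * n) n Q) (σ₀ : Fin Z.numCells)
    (i₀ : Fin (n + 1))
    (halone : ∀ i : Fin (n + 1), Z.facetClass σ₀ i = Z.facetClass σ₀ i₀ → i = i₀)
    (hnull : ∀ σ, σ ≠ σ₀ → ∀ i : Fin (n + 1), Z.facetClass σ i = Z.facetClass σ₀ i₀ →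
      frameComplexDet n (Z.cell σ).frame = 0) :
    frameComplexDet n (Z.cell σ₀).frame = 0 := by
  have h := sum_facetClass_frameComplexDet_eq_zero Z (Z.facetClass σ₀ i₀)
  -- all terms vanish except the slot `(σ₀, i₀)`
  rw [Finset.sum_eq_single σ₀, Finset.sum_eq_single i₀, if_pos rfl] at h
  · have hw : ((Z.cell σ₀).weight : ℂ) ≠ 0 := Nat.cast_ne_zero.mpr (Nat.pos_iff_ne_zero.mp (Z.cell σ₀).weight_pos)
    have hs : (((Equiv.Perm.sign (Z.facetPerm σ₀ i₀) : ℤˣ) : ℤ) : ℂ) ≠ 0 := by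
      rcases Int.units_eq_one_or (Equiv.Perm.sign (Z.facetPerm σ₀ i₀)) with h1 | h1 <;> simp [h1]
    have hm : (-1 : ℂ) ^ ((i₀ : Fin (n + 1)) : ℕ) ≠ 0 := pow_ne_zero _ (neg_ne_zero.mpr one_ne_zero)
    have := mul_eq_zero.mp h
    rcases this with h0 | h0
    · exfalso; exact (mul_ne_zero (mul_ne_zero hw hm) hs) h0
    · exact h0
  · intro i _ hi
    rw [if_neg (fun hc => hi (halone i hc))]
  · intro hi; exact absurd (Finset.mem_univ i₀) hi
  · intro σ _ hσ
    refine Finset.sum_eq_zero fun i _ => ?_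
    split_ifs with hc
    · rw [hnull σ hσ i hc, mul_zero]
    · rfl
  · intro hσ; exact absurd (Finset.mem_univ σ₀) hσ

end Summit.HodgeConjecture.HodgeConjecture.Theorems.TropicalWeilVanishing.EtaBalance

end
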